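import Literature.NumberTheory.LFunctions.RodgersTaoEnergy
import HarnessLib

/-!
# Rodgers–Tao 2020, §1.2 «Notation» (the part not in `RodgersTaoZeroDynamics.lean`): `log₊`, the
classical locations `ξ_j` for `j ∈ ℤ*`, and the nearby relation `j ∼_T k`

RH-FREE VOCABULARY (no named facts, no theorems of the paper). Trunk T-ANT
(`Literature/NumberTheory/LFunctions`). This module types the remaining objects of the *Notation*
subsection (§1.2 of arXiv:1801.05914v4 = FMP 8 (2020) e6, pp. 6–7; v5 TeX l.175–198) of
B. Rodgers, T. Tao, *The de Bruijn–Newman constant is non-negative*, together with the odd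
extension of the classical locations (§3, after (42)), so that the section files of the paper
(§§2–8, typed by the rh-crit/rt cell) share ONE rendering of them. The `ℤ*`-indexed zeros
`x_j(t)` = `deBruijnZeroZ`, the discrete intervals `[a, b]_{ℤ*}` = `zstarIcc`, `ℤ* ∖ K` =
`zstarCompl` and the principal-value velocity sums were typed first, in
`RodgersTaoZeroDynamics.lean` (§4) — import that file for them; they are NOT redeclared here. This
module adds nothing mathematical to the tree: every definition below is an explicit elementary
function, an odd extension, or a predicate, and every lemma is an unfolding / symmetry / sign
statement.

## Contents (namespace `Literature.NumberTheory.LFunctions`)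

* `logPlus x = log (2 + |x|)` — the modified logarithm `log₊` ("To avoid the minor issue of the
  logarithm occasionally being negative, we will use the modified logarithm
  `log₊(x) := log(2 + |x|)`", §1.2), with `log_two_le_logPlus`, `logPlus_pos`, `logPlus_mono`,
  `log_le_logPlus`.
* `classicalLocationZ j` — the classical location `ξ_j` for `j ∈ ℤ`: `ξ_j = sign(j) · ξ_{|j|}`, the
  odd extension of the tree's `classicalLocation` (§3, after (42): "extend this to negative `j` by
  setting `ξ_{−j} := −ξ_j`"), `ξ_0 = 0` junk. Bridges: `classicalLocationZ_natCast`,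
  `classicalLocationZ_neg`, `strictMono_classicalLocationZ` ("Clearly the `ξ_j` are increasing in
  `j`"), `classicalLocationZ_ne_zero`, `classicalLocationZ_sub_ne_zero`.
* `Nearby T j k` — "we say that indices `j, k` are *nearby*, and write `j ∼_T k`, if one has
  `0 < |j − k| < (T² + |j| + |k|)^{0.1}`" (§1.2); `Nearby.symm`, `Nearby.ne`, `not_nearby_self`.

## What is NOT here

The asymptotic notations `X ≪ Y`, `O(·)`, `o_{T→∞}(·)`, `X ≍ Y`, `X ≲ Y = Õ(Y)`
(= `O(Y log^{O(1)} T)`, §1.2) are not objects: each typed statement renders them with explicit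
constants (`∃ C, … ≤ C · Y`; `∀ ε > 0, ∃ T₀, ∀ T ≥ T₀, … ≤ ε · Y`; `∃ A C, … ≤ C · log T ^ A · Y`),
as `RodgersTao.lean` / `RodgersTaoEnergy.lean` already do. The standing hypothesis `Λ < 0` of
§1.2 is NOT asserted anywhere (it is refuted in the tree: `rodgers_tao_holds`); files that type
§§2–8 carry it as an explicit antecedent in the tree's witness form
`∀ t₀ < 0, HasOnlyRealZeros (deBruijnH t₀) → …`. `Ψ`, `ξ_j` (`j ≥ −1` real), `N_t`, `x_j` (`j : ℕ`),
`V`, `Ẽ` (positive indices) are in `RodgersTaoEnergy.lean`; `x_j` (`j : ℤ`), `[a,b]_{ℤ*}`, `H_{jk}`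
(57), `E_{jk}` (58) in `RodgersTaoZeroDynamics.lean`.

## References

* B. Rodgers, T. Tao, *The de Bruijn–Newman constant is non-negative*, Forum Math. Pi 8 (2020),
  e6 (doi:10.1017/fmp.2020.6) = arXiv:1801.05914 (v4 §1.2 "Notation", l.210–238; v5 l.175–198;
  FMP pp. 6–7); §3 after eq. (42) (FMP p. 21) for `ξ_{−j} := −ξ_j`.
-/

noncomputable section

open Real Filter Set
open scoped Topology

namespace Literature.NumberTheory.LFunctions

/-! ## The modified logarithm `log₊` -/

/-- The modified logarithm `log₊ x := log (2 + |x|)` of Rodgers–Tao 2020, §1.2 ("To avoid the minor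
issue of the logarithm occasionally being negative"). It is `≥ log 2 > 0` everywhere.
[cite: RodgersTaoFMP2020, §1.2 Notation (FMP 8 (2020) e6 p.6) = arXiv:1801.05914v4 §1.2] -/
def logPlus (x : ℝ) : ℝ :=
  Real.log (2 + |x|)

/-- Unfolding lemma for `log₊`.
[cite: RodgersTaoFMP2020, §1.2 Notation (FMP 8 (2020) e6 p.6) = arXiv:1801.05914v4 §1.2] -/
theorem logPlus_eq (x : ℝ) : logPlus x = Real.log (2 + |x|) := rfl

/-- `log₊` is even.
[cite: RodgersTaoFMP2020, §1.2 Notation (FMP 8 (2020) e6 p.6) = arXiv:1801.05914v4 §1.2] -/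
@[simp] theorem logPlus_neg (x : ℝ) : logPlus (-x) = logPlus x := by
  simp [logPlus]

/-- `log₊ |x| = log₊ x`.
[cite: RodgersTaoFMP2020, §1.2 Notation (FMP 8 (2020) e6 p.6) = arXiv:1801.05914v4 §1.2] -/
@[simp] theorem logPlus_abs (x : ℝ) : logPlus |x| = logPlus x := by
  simp [logPlus]

/-- `log 2 ≤ log₊ x`.
[cite: RodgersTaoFMP2020, §1.2 Notation (FMP 8 (2020) e6 p.6) = arXiv:1801.05914v4 §1.2] -/
theorem log_two_le_logPlus (x : ℝ) : Real.log 2 ≤ logPlus x :=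
  Real.log_le_log (by norm_num) (by linarith [abs_nonneg x])

/-- `0 < log₊ x`.
[cite: RodgersTaoFMP2020, §1.2 Notation (FMP 8 (2020) e6 p.6) = arXiv:1801.05914v4 §1.2] -/
theorem logPlus_pos (x : ℝ) : 0 < logPlus x :=
  lt_of_lt_of_le (Real.log_pos (by norm_num)) (log_two_le_logPlus x)

/-- `0 ≤ log₊ x`.
[cite: RodgersTaoFMP2020, §1.2 Notation (FMP 8 (2020) e6 p.6) = arXiv:1801.05914v4 §1.2] -/
theorem logPlus_nonneg (x : ℝ) : 0 ≤ logPlus x := (logPlus_pos x).le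

/-- `log₊` is monotone in `|x|`.
[cite: RodgersTaoFMP2020, §1.2 Notation (FMP 8 (2020) e6 p.6) = arXiv:1801.05914v4 §1.2] -/
theorem logPlus_mono {x y : ℝ} (h : |x| ≤ |y|) : logPlus x ≤ logPlus y :=
  Real.log_le_log (by linarith [abs_nonneg x]) (by linarith)

/-- `log x ≤ log₊ x` (for every real `x`; `log x ≤ 0` when `x ≤ 1`).
[cite: RodgersTaoFMP2020, §1.2 Notation (FMP 8 (2020) e6 p.6) = arXiv:1801.05914v4 §1.2] -/
theorem log_le_logPlus (x : ℝ) : Real.log x ≤ logPlus x := by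
  rcases eq_or_ne x 0 with rfl | hx
  · simp [logPlus_nonneg]
  · rw [← Real.log_abs]
    exact Real.log_le_log (abs_pos.2 hx) (by linarith [abs_nonneg x])

/-- A natural number, cast to `ℝ`, lies in `[-1, ∞)` (the domain of the tree's `classicalLocation`
API). [folklore] -/
private theorem natCast_mem_Ici_neg_one (n : ℕ) : ((n : ℝ)) ∈ Ici (-1 : ℝ) := by
  simp only [mem_Ici]
  have : (0 : ℝ) ≤ n := Nat.cast_nonneg n
  linarith

/-! ## The classical locations `ξ_j` indexed by `ℤ*` -/

/-- `ξ_j` for `j ∈ ℤ`: the odd extension `ξ_j = sign(j) · ξ_{|j|}` of the tree's classical location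
`classicalLocation` (Rodgers–Tao 2020, §3, after (42): "Define the classical location `ξ_j` of the
`j`-th zero for `j ≥ 1` … and extend this to negative `j` by setting `ξ_{−j} := −ξ_j`"). Junk:
`ξ_0 = 0` (the index `0 ∉ ℤ*` is never used; note `classicalLocation 0 = 4πe ≠ 0` is NOT this value).
[cite: RodgersTaoFMP2020, §3 after eq. (42) (FMP 8 (2020) e6 p.21) = arXiv:1801.05914v4 §3] -/
def classicalLocationZ (j : ℤ) : ℝ :=
  (j.sign : ℝ) * classicalLocation (j.natAbs : ℝ)

/-- Unfolding lemma for `classicalLocationZ`.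
[cite: RodgersTaoFMP2020, §3 after eq. (42) (FMP 8 (2020) e6 p.21) = arXiv:1801.05914v4 §3] -/
theorem classicalLocationZ_eq (j : ℤ) :
    classicalLocationZ j = (j.sign : ℝ) * classicalLocation (j.natAbs : ℝ) := rfl

/-- On positive natural-number indices, `ξ_{(n : ℤ)} = ξ_n`.
[cite: RodgersTaoFMP2020, §3 after eq. (42) (FMP 8 (2020) e6 p.21) = arXiv:1801.05914v4 §3] -/
theorem classicalLocationZ_natCast {n : ℕ} (hn : n ≠ 0) :
    classicalLocationZ n = classicalLocation (n : ℝ) := by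
  have : (n : ℤ).sign = 1 := Int.sign_eq_one_of_pos (by exact_mod_cast Nat.pos_of_ne_zero hn)
  simp [classicalLocationZ, this]

/-- `ξ_{(n+1 : ℤ)} = ξ_{n+1}`.
[cite: RodgersTaoFMP2020, §3 after eq. (42) (FMP 8 (2020) e6 p.21) = arXiv:1801.05914v4 §3] -/
@[simp] theorem classicalLocationZ_natCast_succ (n : ℕ) :
    classicalLocationZ ((n + 1 : ℕ) : ℤ) = classicalLocation ((n + 1 : ℕ) : ℝ) :=
  classicalLocationZ_natCast (Nat.succ_ne_zero n)

/-- `ξ_{−j} = −ξ_j` (§3).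
[cite: RodgersTaoFMP2020, §3 after eq. (42) (FMP 8 (2020) e6 p.21) = arXiv:1801.05914v4 §3] -/
@[simp] theorem classicalLocationZ_neg (j : ℤ) : classicalLocationZ (-j) = -classicalLocationZ j := by
  simp [classicalLocationZ, Int.sign_neg, Int.natAbs_neg]

/-- `ξ_0 = 0` (junk index).
[cite: RodgersTaoFMP2020, §3 after eq. (42) (FMP 8 (2020) e6 p.21) = arXiv:1801.05914v4 §3] -/
@[simp] theorem classicalLocationZ_zero : classicalLocationZ 0 = 0 := by
  simp [classicalLocationZ]

/-- `ξ_j > 0` for `j ≥ 1` (indeed `ξ_j ≥ 4π`).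
[cite: RodgersTaoFMP2020, §3 after eq. (42) (FMP 8 (2020) e6 p.21) = arXiv:1801.05914v4 §3] -/
theorem classicalLocationZ_pos {j : ℤ} (hj : 0 < j) : 0 < classicalLocationZ j := by
  obtain ⟨n, rfl⟩ := Int.eq_ofNat_of_zero_le hj.le
  have hn : n ≠ 0 := by rintro rfl; omega
  rw [classicalLocationZ_natCast hn]
  exact classicalLocation_pos (natCast_mem_Ici_neg_one n)

/-- `4π ≤ ξ_j` for `j ≥ 1`.
[cite: RodgersTaoFMP2020, §3 after eq. (42) (FMP 8 (2020) e6 p.21) = arXiv:1801.05914v4 §3] -/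
theorem four_pi_le_classicalLocationZ {j : ℤ} (hj : 0 < j) : 4 * π ≤ classicalLocationZ j := by
  obtain ⟨n, rfl⟩ := Int.eq_ofNat_of_zero_le hj.le
  have hn : n ≠ 0 := by rintro rfl; omega
  rw [classicalLocationZ_natCast hn]
  exact four_pi_le_classicalLocation (natCast_mem_Ici_neg_one n)

/-- "Clearly the `ξ_j` are increasing in `j`" (§3): with `ξ_0 = 0` the map `j ↦ ξ_j` is strictly
increasing on all of `ℤ`.
[cite: RodgersTaoFMP2020, §3 after eq. (42) (FMP 8 (2020) e6 p.21) = arXiv:1801.05914v4 §3] -/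
theorem strictMono_classicalLocationZ : StrictMono classicalLocationZ := by
  have key : ∀ j k : ℤ, j < k → 0 ≤ j → classicalLocationZ j < classicalLocationZ k := by
    intro j k hjk hj
    rcases hj.eq_or_lt with rfl | hj0
    · rw [classicalLocationZ_zero]; exact classicalLocationZ_pos hjk
    · obtain ⟨m, rfl⟩ := Int.eq_ofNat_of_zero_le hj
      obtain ⟨n, rfl⟩ := Int.eq_ofNat_of_zero_le (hj.trans hjk.le)
      have hm : m ≠ 0 := by rintro rfl; omega
      have hn : n ≠ 0 := by rintro rfl; omega
      rw [classicalLocationZ_natCast hm, classicalLocationZ_natCast hn]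
      exact strictMonoOn_classicalLocation (natCast_mem_Ici_neg_one m) (natCast_mem_Ici_neg_one n)
        (by exact_mod_cast hjk)
  intro j k hjk
  rcases le_or_gt 0 j with hj | hj
  · exact key j k hjk hj
  · rcases le_or_gt k 0 with hk | hk
    · have := key (-k) (-j) (by omega) (by omega)
      rw [classicalLocationZ_neg, classicalLocationZ_neg] at this
      linarith
    · have h1 := key 0 k hk le_rfl
      have h2 := key 0 (-j) (by omega) le_rfl
      rw [classicalLocationZ_zero] at h1 h2
      rw [classicalLocationZ_neg] at h2
      linarith

/-- `ξ_j ≠ 0` for `j ∈ ℤ*`.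
[cite: RodgersTaoFMP2020, §3 after eq. (42) (FMP 8 (2020) e6 p.21) = arXiv:1801.05914v4 §3] -/
theorem classicalLocationZ_ne_zero {j : ℤ} (hj : j ≠ 0) : classicalLocationZ j ≠ 0 := by
  intro h
  rw [← classicalLocationZ_zero] at h
  exact hj (strictMono_classicalLocationZ.injective h)

/-- `ξ_j ≠ ξ_k` for `j ≠ k`.
[cite: RodgersTaoFMP2020, §3 after eq. (42) (FMP 8 (2020) e6 p.21) = arXiv:1801.05914v4 §3] -/
theorem classicalLocationZ_sub_ne_zero {j k : ℤ} (hjk : j ≠ k) :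
    classicalLocationZ k - classicalLocationZ j ≠ 0 :=
  sub_ne_zero.2 fun h ↦ hjk (strictMono_classicalLocationZ.injective h).symm

/-! ## The nearby relation `j ∼_T k` -/

/-- "We say that indices `j, k` are *nearby*, and write `j ∼_T k`, if one has
`0 < |j − k| < (T² + |j| + |k|)^{0.1}`" (Rodgers–Tao 2020, §1.2).
[cite: RodgersTaoFMP2020, §1.2 Notation (FMP 8 (2020) e6 p.7) = arXiv:1801.05914v4 §1.2] -/
def Nearby (T : ℝ) (j k : ℤ) : Prop :=
  j ≠ k ∧ |(j : ℝ) - k| < (T ^ 2 + |(j : ℝ)| + |(k : ℝ)|) ^ (1 / 10 : ℝ)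

/-- Unfolding lemma for `Nearby`.
[cite: RodgersTaoFMP2020, §1.2 Notation (FMP 8 (2020) e6 p.6) = arXiv:1801.05914v4 §1.2] -/
theorem nearby_iff {T : ℝ} {j k : ℤ} :
    Nearby T j k ↔ j ≠ k ∧ |(j : ℝ) - k| < (T ^ 2 + |(j : ℝ)| + |(k : ℝ)|) ^ (1 / 10 : ℝ) :=
  Iff.rfl

/-- `∼_T` is symmetric ("This is clearly a symmetric relation", §7).
[cite: RodgersTaoFMP2020, §1.2 Notation (FMP 8 (2020) e6 p.6) = arXiv:1801.05914v4 §1.2] -/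
theorem Nearby.symm {T : ℝ} {j k : ℤ} (h : Nearby T j k) : Nearby T k j := by
  refine ⟨h.1.symm, ?_⟩
  rw [abs_sub_comm, add_right_comm (T ^ 2)]
  exact h.2

/-- `∼_T` is symmetric, as an `iff`.
[cite: RodgersTaoFMP2020, §1.2 Notation (FMP 8 (2020) e6 p.6) = arXiv:1801.05914v4 §1.2] -/
theorem nearby_comm {T : ℝ} {j k : ℤ} : Nearby T j k ↔ Nearby T k j :=
  ⟨Nearby.symm, Nearby.symm⟩

/-- Nearby indices are distinct.
[cite: RodgersTaoFMP2020, §1.2 Notation (FMP 8 (2020) e6 p.6) = arXiv:1801.05914v4 §1.2] -/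
theorem Nearby.ne {T : ℝ} {j k : ℤ} (h : Nearby T j k) : j ≠ k := h.1

/-- `∼_T` is irreflexive.
[cite: RodgersTaoFMP2020, §1.2 Notation (FMP 8 (2020) e6 p.6) = arXiv:1801.05914v4 §1.2] -/
theorem not_nearby_self (T : ℝ) (j : ℤ) : ¬Nearby T j j := fun h ↦ h.1 rfl

end Literature.NumberTheory.LFunctions

end
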